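import Mathlib
import HarnessLib
import Literature.MathematicalPhysics.KineticTheory.HardSphereEulerProofs
import Literature.MathematicalPhysics.KineticTheory.HardSphereEulerLLN
import Literature.MathematicalPhysics.KineticTheory.HardSphereTwoTimePressure
import Summits.AtomisticToContinuum.HydrodynamicLimit.Theses.OneFlightGossipEngine
import Summits.AtomisticToContinuum.HydrodynamicLimit.Theorems.OneFlightGossipEngineKineticCurrentsLDAlongFamiliesLawChange
import Summits.AtomisticToContinuum.HydrodynamicLimit.Theorems.OneFlightGossipEngineKineticCurrentsLDAlongFamiliesTransferByNets
import Summits.AtomisticToContinuum.HydrodynamicLimit.Theorems.OneFlightGossipEngineLocalClampedTransferLDAlongFamiliesEosFieldFamilyModulus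
import Summits.AtomisticToContinuum.HydrodynamicLimit.Theorems.OneFlightGossipEngineLocalClampedTransferLDAlongFamiliesWindowEnergyExpMoment
import Summits.AtomisticToContinuum.HydrodynamicLimit.Theorems.OneFlightGossipEngineLocalClampedTransferLDAlongFamiliesClampedFunctionalMeasurable
import Summits.AtomisticToContinuum.HydrodynamicLimit.Theorems.OneFlightGossipEngineLocalClampedTransferLDAlongFamiliesSAxisNetPrelim
import Summits.AtomisticToContinuum.HydrodynamicLimit.Theorems.OneFlightGossipEngineLocalClampedTransferLDAlongFamiliesSAxisNetPathwise
import Summits.AtomisticToContinuum.HydrodynamicLimit.Theorems.OneFlightGossipEngineLocalClampedTransferLDAlongFamiliesSAxisNetChain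
import Summits.AtomisticToContinuum.HydrodynamicLimit.Theorems.OneFlightGossipEngineLocalClampedTransferLDAlongFamiliesSAxisNetNode

/-!
# The s-axis net: `LCT♯ → crux` — stub `stub_sAxisNet` of line `Sketch`,
# crux `LocalClampedTransferLDAlongFamilies` (stmt-AtomisticToContinuum-17691)

Route `OneFlightGossipEngine`, sub-problem `HydrodynamicLimit`. The crux (transfer-clamped collisional window LD under the
local Gibbs REFERENCE law, EOS-projected and centred, UNIFORM along a jointly continuous positive profile family and a
jointly smooth test family on `[0,t₁]`) from the profile-wise node `LCTSharp` (numeric `V₀, β₀`; `τ₀, N₀` after the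
profile and the test function). Finite net in `s` (template: the kinetic twin's `stub_transferByNets`):
`η₀ := min(η₀♯, η₁)`; family bounds `(Θ,U,Λ)`, test bounds `Lφ`, mixed modulus `Kφ`; `V₀, β₀♯` from the node,
`β₀ := β₀♯/4`; given `(β, ε)`: energy exponent `γ(ε/8)` (`stub_windowEnergyExpMoment`), change of law `δ₂(ε/8)`
(`stub_lawChangeFamily`), transverse moduli of the coefficient slab fields of the EOS projection (jointly continuous by
`stub_eosFieldFamilyModulus` / `continuousOn_slab_partialDeriv`) at a tolerance `ω(ε,β,γ,bounds)`; net `s_k = min(t₁,kδ)`,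
node statements at tilt `4β` and precision `ε` (`tbn_net_thresholds`); for `s′` within `δ` of `s_k`, `row_chain` for
each of the four rows with the measurable versions of `stub_clampedFunctionalMeasurable` and the pathwise data.

References: S. Olla, S. R. S. Varadhan, H.-T. Yau, Comm. Math. Phys. 155 (1993) §3; H. Spohn, *Large Scale Dynamics of
Interacting Particles* (1991), Part I §2.3.
-/

noncomputable section

open MeasureTheory Set Filter
open scoped ENNReal Topology BigOperators

namespace Summit.AtomisticToContinuum.HydrodynamicLimit.Theorems.LocalClampedTransferSketch

open Literature.Analysis.FluidPDE (HardSphereFlow Config localMaxwellian canonicalDensity liouville)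
open Literature.MathematicalPhysics.KineticTheory (T3 V3 hsDiameter localGibbsLaw localGibbsProfile rhoLim
  profileOf hsCompressibility)
open Literature.Analysis.FluidPDE Literature.MathematicalPhysics.KineticTheory Literature.Analysis.FunctionSpaces
open Summit.AtomisticToContinuum.HydrodynamicLimit.Theses.OneFlightGossipEngine (LocalClampedTransferLDAlongFamilies)
open Summit.AtomisticToContinuum.HydrodynamicLimit.Theorems.KineticCurrentsLDAlongFamiliesSketch
  (stub_lawChangeFamily tbn_net_thresholds)
open Summit.AtomisticToContinuum.HydrodynamicLimit.Theorems.KineticCurrentsLDAlongFamiliesSketch.LawChange (exists_bounds)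

/-! ### The net transfer -/

set_option maxHeartbeats 1600000 in -- one declaration: the whole threshold bookkeeping of the net (four rows of a
-- 4000-character functional; the twin `stub_transferByNets` has one row) elaborated once
/-- **S5 — the s-axis net transfer** `LCT♯ → LocalClampedTransferLDAlongFamilies` (stub `stub_sAxisNet` of line `Sketch`,
crux stmt-AtomisticToContinuum-17691): the family crux from the profile-wise node with numeric clamp/tilt thresholds, by a
finite net in the family parameter, the static change of reference law, the pathwise Lipschitz continuity of the
transfer-clamped rows in the test function, the one-body modulus of the x-frozen EOS projections (jointly continuous EOS
fields) priced by the exponential moment of the window energy, and the continuity of the centrings. -/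
theorem stub_sAxisNet : LCTSharp → LocalClampedTransferLDAlongFamilies := by
  rintro ⟨ηK, hηK, hK⟩
  obtain ⟨η₁, hη₁, hE⟩ := stub_eosFieldFamilyModulus
  show LocalClampedTransferLDAlongFamilies
  delta LocalClampedTransferLDAlongFamilies
  refine ⟨min ηK η₁, lt_min hηK hη₁, ?_⟩
  intro t₁ a θ₀ u₀ ha hac hθ hu ha0 hθ0 σ hσ hσ2 hguard Φ φ hφ
  -- the degenerate parameter interval `t₁ < 0`: everything is vacuous
  by_cases ht : t₁ < 0
  · refine ⟨1, one_pos, fun V _ => ⟨1, one_pos, fun β _ ε _ => ⟨1, one_pos, fun τ _ => ⟨0, fun N _ s hs => ?_⟩⟩⟩⟩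
    exact absurd (hs.1.trans hs.2) (not_le.2 ht)
  replace ht : 0 ≤ t₁ := not_lt.1 ht
  -- Step 1: the two guards
  have hint : ∀ s, 0 ≤ ∫ x, a s x := fun s => integral_nonneg fun x => (ha0 s x).le
  have hgK : ∀ s ∈ Icc 0 t₁, σ ^ 3 * (⨆ x, a s x) ≤ ηK * ∫ x, a s x := fun s hs =>
    (hguard s hs).trans (mul_le_mul_of_nonneg_right (min_le_left _ _) (hint s))
  have hg1 : ∀ s ∈ Icc 0 t₁, σ ^ 3 * (⨆ x, a s x) ≤ η₁ * ∫ x, a s x := fun s hs =>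
    (hguard s hs).trans (mul_le_mul_of_nonneg_right (min_le_right _ _) (hint s))
  -- Step 2: constants of the family and of the test family
  obtain ⟨Θ, hΘ0, hΘb⟩ := exists_bounds t₁ hθ hθ0
  obtain ⟨Λ, hΛ0, hΛb⟩ := exists_bounds t₁ hac ha0
  have huc : ContinuousOn (fun p : ℝ × T3 => u₀ p.1 p.2) (Icc 0 t₁ ×ˢ univ) := hu.continuousOn
  obtain ⟨U, hU0, hUb⟩ := exists_bound_of_continuousOn t₁ (F := fun p : ℝ × T3 => ‖u₀ p.1 p.2‖) huc.norm
  have hUb' : ∀ s ∈ Icc 0 t₁, ∀ x, ‖u₀ s x‖ ≤ U := fun s hs x => (le_abs_self _).trans (hUb s hs x)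
  obtain ⟨Lφ, hLφ0, hLφ⟩ := exists_testFamily_derivBounds hφ
  obtain ⟨Kφ, hKφ0, hKφ⟩ := exists_testFamily_mixed hφ
  -- Step 3: the EOS fields along the family are jointly continuous on the slab
  obtain ⟨hρc, hZc, hZ'c⟩ := hE t₁ a ha hac ha0 σ hσ hσ2 hg1
  have hθc : ContinuousOn (fun p : ℝ × T3 => θ₀ p.1 p.2) (Icc 0 t₁ ×ˢ univ) := hθ.continuousOn
  have hdφc : ∀ k : Fin 3, ContinuousOn (fun p : ℝ × T3 => Torus.partialDeriv k (φ p.1) p.2) (Icc 0 t₁ ×ˢ univ) :=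
    fun k => continuousOn_slab_partialDeriv hφ k
  -- the coefficient slab fields of the EOS projections
  set ρF : ℝ × T3 → ℝ := fun p => rhoLim (profileOf (a p.1) (ha p.1) (ha0 p.1)) σ p.2 with hρF
  set ZF : ℝ × T3 → ℝ := fun p => hsCompressibility (ρF p * σ ^ 3) with hZF
  set Z'F : ℝ × T3 → ℝ := fun p => deriv hsCompressibility (ρF p * σ ^ 3) with hZ'F
  set BF : ℝ × T3 → ℝ := fun p => θ₀ p.1 p.2 * (ρF p * σ ^ 3) * Z'F p with hBF
  set pmF : ℝ × T3 → Fin 3 → ℝ := fun p k => Torus.partialDeriv k (φ p.1) p.2 * BF p with hpmF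
  set qmF : ℝ × T3 → Fin 3 → ℝ := fun p k => Torus.partialDeriv k (φ p.1) p.2 * ((1 / 3) * (ZF p - 1)) with hqmF
  set sF : ℝ × T3 → ℝ := fun p => ∑ l : Fin 3, u₀ p.1 p.2 l * Torus.partialDeriv l (φ p.1) p.2 with hsF
  set peF : ℝ × T3 → ℝ := fun p => sF p * BF p with hpeF
  set qeF : ℝ × T3 → ℝ := fun p => sF p * ((1 / 3) * (ZF p - 1)) with hqeF
  set reF : ℝ × T3 → Fin 3 → ℝ := fun p l => θ₀ p.1 p.2 * (ZF p - 1) * Torus.partialDeriv l (φ p.1) p.2 with hreF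
  set ImF : ℝ × T3 → Fin 3 → ℝ := fun p k => ρF p * Torus.partialDeriv k (φ p.1) p.2 * BF p with hImF
  set IeF : ℝ × T3 → ℝ := fun p => ρF p * sF p * BF p with hIeF
  have hBFc : ContinuousOn BF (Icc 0 t₁ ×ˢ univ) := (hθc.mul (hρc.mul continuousOn_const)).mul hZ'c
  have hpmc : ContinuousOn pmF (Icc 0 t₁ ×ˢ univ) := continuousOn_pi.2 fun k => (hdφc k).mul hBFc
  have hqmc : ContinuousOn qmF (Icc 0 t₁ ×ˢ univ) :=
    continuousOn_pi.2 fun k => (hdφc k).mul (continuousOn_const.mul (hZc.sub continuousOn_const))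
  have hul : ∀ l : Fin 3, ContinuousOn (fun p : ℝ × T3 => u₀ p.1 p.2 l) (Icc 0 t₁ ×ˢ univ) := fun l =>
    (show Continuous (fun v : V3 => v l) from by fun_prop).comp_continuousOn huc
  have hsFc : ContinuousOn sF (Icc 0 t₁ ×ˢ univ) := continuousOn_finsetSum _ fun l _ => (hul l).mul (hdφc l)
  have hpec : ContinuousOn peF (Icc 0 t₁ ×ˢ univ) := hsFc.mul hBFc
  have hqec : ContinuousOn qeF (Icc 0 t₁ ×ˢ univ) := hsFc.mul (continuousOn_const.mul (hZc.sub continuousOn_const))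
  have hrec : ContinuousOn reF (Icc 0 t₁ ×ˢ univ) :=
    continuousOn_pi.2 fun l => (hθc.mul (hZc.sub continuousOn_const)).mul (hdφc l)
  have hImc : ContinuousOn ImF (Icc 0 t₁ ×ˢ univ) := continuousOn_pi.2 fun k => (hρc.mul (hdφc k)).mul hBFc
  have hIec : ContinuousOn IeF (Icc 0 t₁ ×ˢ univ) := (hρc.mul hsFc).mul hBFc
  -- numeric bounds of the coefficient fields
  obtain ⟨Q₁, hQ₁0, hQ₁⟩ := exists_bound_of_continuousOn t₁ (F := fun p => ‖qmF p‖) hqmc.norm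
  obtain ⟨Q₂, hQ₂0, hQ₂⟩ := exists_bound_of_continuousOn t₁ (F := qeF) hqec
  obtain ⟨R, hR0, hR⟩ := exists_bound_of_continuousOn t₁ (F := fun p => ‖reF p‖) hrec.norm
  set Q : ℝ := max Q₁ Q₂ with hQ
  have hQ0 : 0 ≤ Q := hQ₁0.trans (le_max_left _ _)
  have hqm_le : ∀ s ∈ Icc 0 t₁, ∀ x (k : Fin 3), |qmF (s, x) k| ≤ Q := fun s hs x k => by
    have h := hQ₁ s hs x
    rw [abs_of_nonneg (norm_nonneg _)] at h
    exact (((Real.norm_eq_abs _).symm.le.trans (norm_le_pi_norm (qmF (s, x)) k)).trans h).trans (le_max_left _ _)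
  have hqe_le : ∀ s ∈ Icc 0 t₁, ∀ x, |qeF (s, x)| ≤ Q := fun s hs x => (hQ₂ s hs x).trans (le_max_right _ _)
  have hre_le : ∀ s ∈ Icc 0 t₁, ∀ x (l : Fin 3), |reF (s, x) l| ≤ R := fun s hs x l => by
    have h := hR s hs x
    rw [abs_of_nonneg (norm_nonneg _)] at h
    exact ((Real.norm_eq_abs _).symm.le.trans (norm_le_pi_norm (reF (s, x)) l)).trans h
  -- Step 4: the thresholds `V₀`, `β₀ = β₁/4` of the node
  obtain ⟨V₀, hV₀, hKV⟩ := hK (max Θ 1) U (max Λ 1) Lφ (le_max_right _ _) hU0 (le_max_right _ _) hLφ0 σ hσ hσ2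
  refine ⟨V₀, hV₀, fun V hV => ?_⟩
  have hVnn : 0 ≤ V := hV₀.le.trans hV
  obtain ⟨β₁, hβ₁, hK1⟩ := hKV V hV
  refine ⟨β₁ / 4, by positivity, fun β hβ ε hε => ?_⟩
  have h4β : |4 * β| ≤ β₁ := by rw [abs_mul, abs_of_pos (by norm_num : (0 : ℝ) < 4)]; linarith
  -- Step 5: energy exponent and change of law at precision `ε/8`; the tolerance `ω`
  obtain ⟨γ, hγ, hT⟩ := stub_windowEnergyExpMoment t₁ a θ₀ u₀ hac hθ hu ha0 hθ0 σ hσ hσ2.le (ε / 8) (by positivity)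
  obtain ⟨δ₂, hδ₂, hlaw⟩ := stub_lawChangeFamily t₁ a θ₀ u₀ hac hθ hu ha0 hθ0 σ hσ hσ2.le (ε / 8) (by positivity)
  set E₁ : ℝ := 1 + 2 * U ^ 2 + Q * (1 + 2 * U) + 3 * ((1 + U) + R) with hE₁
  set E₂ : ℝ := 2 + Q + 3 with hE₂
  set D₁ : ℝ := Kφ * V / 2 + E₁ + 1 with hD₁
  have hE₁0 : 0 ≤ E₁ := by positivity
  have hE₂0 : 0 ≤ E₂ := by positivity
  have hD₁0 : 0 ≤ D₁ := by positivity
  obtain ⟨ω, hω0, hω1, hωε, hωγ⟩ : ∃ ω : ℝ, 0 < ω ∧ ω ≤ 1 ∧ ω ≤ ε / (16 * (4 * |β| * D₁ + 1)) ∧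
      ω ≤ γ / (4 * |β| * E₂ + 1) :=
    ⟨min 1 (min (ε / (16 * (4 * |β| * D₁ + 1))) (γ / (4 * |β| * E₂ + 1))), by positivity, min_le_left _ _,
      (min_le_right _ _).trans (min_le_left _ _), (min_le_right _ _).trans (min_le_right _ _)⟩
  -- Step 6: transverse moduli at tolerance `ω`, and the net spacing `δ`
  obtain ⟨d₁, hd₁, hm₁⟩ := exists_family_modulus_of_continuousOn t₁ hpmc hω0
  obtain ⟨d₂, hd₂, hm₂⟩ := exists_family_modulus_of_continuousOn t₁ hqmc hω0
  obtain ⟨d₃, hd₃, hm₃⟩ := exists_family_modulus_of_continuousOn t₁ hpec hω0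
  obtain ⟨d₄, hd₄, hm₄⟩ := exists_family_modulus_of_continuousOn t₁ hqec hω0
  obtain ⟨d₅, hd₅, hm₅⟩ := exists_family_modulus_of_continuousOn t₁ hrec hω0
  obtain ⟨d₆, hd₆, hm₆⟩ := exists_family_modulus_of_continuousOn t₁ huc hω0
  obtain ⟨d₇, hd₇, hm₇⟩ := exists_family_modulus_of_continuousOn t₁ hImc hω0
  obtain ⟨d₈, hd₈, hm₈⟩ := exists_family_modulus_of_continuousOn t₁ hIec hω0
  obtain ⟨δ, hδ, hδω, hδ₂', hδ1, hδ2, hδ3, hδ4, hδ5, hδ6, hδ7, hδ8⟩ : ∃ δ : ℝ, 0 < δ ∧ δ ≤ ω ∧ δ ≤ δ₂ ∧ δ ≤ d₁ ∧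
      δ ≤ d₂ ∧ δ ≤ d₃ ∧ δ ≤ d₄ ∧ δ ≤ d₅ ∧ δ ≤ d₆ ∧ δ ≤ d₇ ∧ δ ≤ d₈ := by
    refine ⟨min (min (min ω δ₂) (min d₁ d₂)) (min (min d₃ d₄) (min (min d₅ d₆) (min d₇ d₈))), by positivity,
      ?_, ?_, ?_, ?_, ?_, ?_, ?_, ?_, ?_, ?_⟩ <;>
    simp only [min_le_iff, le_refl, true_or, or_true]
  -- Step 7: the net `s_k = min t₁ (kδ)` and the node statements (tilt `4β`, precision `ε`)
  obtain ⟨sk, hsk, hsk_eq⟩ : ∃ sk : ℕ → ℝ, (∀ k, sk k ∈ Icc 0 t₁) ∧ ∀ k : ℕ, (k : ℝ) * δ ≤ t₁ → sk k = k * δ :=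
    ⟨fun k => min t₁ (k * δ), fun k => ⟨le_min ht (by positivity), min_le_left _ _⟩, fun k hk => min_eq_right hk⟩
  have hnet := fun k : ℕ =>
    hK1 (a (sk k)) (θ₀ (sk k)) (u₀ (sk k)) (ha (sk k)) (hθ.uncurry_left _) (hu.uncurry_left _) (ha0 (sk k))
      (hθ0 (sk k)) (fun x => bounds_max_one hΛ0 (hΛb _ (hsk k) x)) (fun x => bounds_max_one hΘ0 (hΘb _ (hsk k) x))
      (hUb' _ (hsk k)) (hgK _ (hsk k)) Φ (φ (sk k)) (hLφ _ (hsk k)).1 (hLφ _ (hsk k)).2.1 (hLφ _ (hsk k)).2.2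
      (4 * β) h4β ε hε
  obtain ⟨τ₀, hτ₀, hnet'⟩ := tbn_net_thresholds (Finset.range (⌈t₁ / δ⌉₊ + 1)) hnet
  refine ⟨τ₀, hτ₀, fun τ hτ => ?_⟩
  have hτpos : 0 < τ := hτ₀.trans_le hτ
  obtain ⟨N₁, hN₁⟩ := hnet' τ hτ
  refine ⟨N₁, fun N hN s' hs' => ?_⟩
  -- Step 8: the nearest node `s₀ = s_k` to the left of `s′`
  obtain ⟨k, hkδ, hs'k, hk_mem⟩ := exists_node hδ hs'
  have hdist : |sk k - s'| ≤ δ := by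
    rw [hsk_eq k (hkδ.trans hs'.2), abs_sub_comm, abs_of_nonneg (by linarith)]
    linarith
  set s₀ : ℝ := sk k with hs₀def
  have hs₀ : s₀ ∈ Icc 0 t₁ := hsk k
  have hdist' : |s' - s₀| ≤ δ := by rwa [abs_sub_comm] at hdist
  -- Step 9: the data at `s′` and at the node
  have hnn : (0 : ℝ) ≤ (N : ℝ) + 1 := by positivity
  have hwpos : 0 < τ * ((N : ℝ) + 1) ^ (-(1 / 3 : ℝ)) := mul_pos hτpos (Real.rpow_pos_of_pos (by positivity) _)
  have hPgood : (localGibbsLaw σ (a s₀) (u₀ s₀) (θ₀ s₀) N (Φ N)) (Φ N).goodᶜ = 0 :=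
    localGibbsLaw_absolutelyContinuous σ _ _ _ N (Φ N) (Φ N).measure_compl_good
  have hP'L := localGibbsLaw_absolutelyContinuous σ (a s') (u₀ s') (θ₀ s') N (Φ N)
  have hlaw' := fun (g : Config (N + 1) (Fin 3) T3 → ℝ≥0∞)
      (hg : AEMeasurable g (liouville (Torus.geometry (Fin 3)) (N + 1) (hsDiameter σ N))) =>
    hlaw Φ N s₀ hs₀ s' hs' (hdist.trans hδ₂') g hg
  have hT' := hT Φ τ hτpos N s₀ hs₀
  -- slice continuity at `s′` and at the node
  have hsl : ∀ s ∈ Icc 0 t₁, Continuous (fun x => ρF (s, x)) ∧ Continuous (fun x => ZF (s, x)) ∧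
      Continuous (fun x => Z'F (s, x)) ∧ (∀ k', Continuous fun x => Torus.partialDeriv k' (φ s) x) ∧
      Continuous (θ₀ s) ∧ Continuous (u₀ s) := fun s hs =>
    ⟨continuous_slice_of_continuousOn hρc hs, continuous_slice_of_continuousOn hZc hs,
      continuous_slice_of_continuousOn hZ'c hs, fun k' => continuous_slice_of_continuousOn (hdφc k') hs,
      hθ.uncurry_left s, hu.uncurry_left s⟩
  -- the mixed modulus of the test family
  have hLip : ∀ x y : T3, |(φ s' x - φ s₀ x) - (φ s' y - φ s₀ y)| ≤ Kφ * δ * Torus.euclidDist x y := by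
    intro x y
    have h := hKφ s' hs' s₀ hs₀ x y
    have hd0 : 0 ≤ Torus.euclidDist x y := by rw [Torus.euclidDist_eq]; exact norm_nonneg _
    calc |(φ s' x - φ s₀ x) - (φ s' y - φ s₀ y)| = |(φ s' x - φ s' y) - (φ s₀ x - φ s₀ y)| := by ring_nf
      _ ≤ Kφ * |s' - s₀| * Torus.euclidDist x y := h
      _ ≤ Kφ * δ * Torus.euclidDist x y := by gcongr
  -- transverse moduli at `(s′, s₀)`
  have hdd : ∀ d, δ ≤ d → |s' - s₀| ≤ d := fun d hd => hdist'.trans hd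
  have hmpm : ∀ x k', |pmF (s', x) k' - pmF (s₀, x) k'| ≤ ω := fun x k' =>
    abs_sub_le_of_dist_pi (hm₁ s' hs' s₀ hs₀ (hdd _ hδ1) x) k'
  have hmqm : ∀ x k', |qmF (s', x) k' - qmF (s₀, x) k'| ≤ ω := fun x k' =>
    abs_sub_le_of_dist_pi (hm₂ s' hs' s₀ hs₀ (hdd _ hδ2) x) k'
  have hmpe : ∀ x, |peF (s', x) - peF (s₀, x)| ≤ ω := fun x =>
    (Real.dist_eq _ _).symm.le.trans (hm₃ s' hs' s₀ hs₀ (hdd _ hδ3) x).le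
  have hmqe : ∀ x, |qeF (s', x) - qeF (s₀, x)| ≤ ω := fun x =>
    (Real.dist_eq _ _).symm.le.trans (hm₄ s' hs' s₀ hs₀ (hdd _ hδ4) x).le
  have hmre : ∀ x l, |reF (s', x) l - reF (s₀, x) l| ≤ ω := fun x l =>
    abs_sub_le_of_dist_pi (hm₅ s' hs' s₀ hs₀ (hdd _ hδ5) x) l
  have hmu : ∀ x, ‖u₀ s' x - u₀ s₀ x‖ ≤ ω := fun x =>
    (dist_eq_norm _ _).symm.le.trans (hm₆ s' hs' s₀ hs₀ (hdd _ hδ6) x).le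
  have hmIm : ∀ x k', |ImF (s', x) k' - ImF (s₀, x) k'| ≤ ω := fun x k' =>
    abs_sub_le_of_dist_pi (hm₇ s' hs' s₀ hs₀ (hdd _ hδ7) x) k'
  have hmIe : ∀ x, |IeF (s', x) - IeF (s₀, x)| ≤ ω := fun x =>
    (Real.dist_eq _ _).symm.le.trans (hm₈ s' hs' s₀ hs₀ (hdd _ hδ8) x).le
  -- the budgets
  have hbudget : 4 * |β| * (Kφ * δ * V / 2 + ω * E₁ + ω) ≤ ε / 16 := by
    have hx : Kφ * V / 2 * δ ≤ Kφ * V / 2 * ω := mul_le_mul_of_nonneg_left hδω (by positivity)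
    have h1 : Kφ * δ * V / 2 + ω * E₁ + ω ≤ ω * D₁ := by
      calc Kφ * δ * V / 2 + ω * E₁ + ω = Kφ * V / 2 * δ + ω * E₁ + ω := by ring
        _ ≤ Kφ * V / 2 * ω + ω * E₁ + ω := by linarith [hx]
        _ = ω * D₁ := by rw [hD₁]; ring
    calc 4 * |β| * (Kφ * δ * V / 2 + ω * E₁ + ω) ≤ 4 * |β| * (ω * D₁) := mul_le_mul_of_nonneg_left h1 (by positivity)
      _ = 4 * |β| * ω * D₁ := by ring
      _ ≤ ε / 16 := budget_le hD₁0 hε hωε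
  have hγ' : 4 * |β| * (ω * E₂) ≤ γ := by
    have hA : 0 ≤ 4 * |β| * E₂ := by positivity
    calc 4 * |β| * (ω * E₂) = (4 * |β| * E₂) * ω := by ring
      _ ≤ (4 * |β| * E₂) * (γ / (4 * |β| * E₂ + 1)) := mul_le_mul_of_nonneg_left hωγ hA
      _ = γ * ((4 * |β| * E₂) / (4 * |β| * E₂ + 1)) := by field_simp
      _ ≤ γ * 1 := mul_le_mul_of_nonneg_left ((div_le_one (by positivity)).2 (by linarith)) hγ.le
      _ = γ := mul_one _
  have hsum : ε / 8 + ε / 4 + (ε / 16 + ε / 8) / 4 ≤ ε := by linarith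
  -- integrability of continuous functions on the torus
  have hInt : ∀ {f : T3 → ℝ}, Continuous f → Integrable f := fun hf =>
    (integrableOn_univ).1 (hf.continuousOn.integrableOn_compact isCompact_univ)
  obtain ⟨hρs', hZs', hZ's', hdφs', hθs', hus'⟩ := hsl s' hs'
  obtain ⟨hρs₀, hZs₀, hZ's₀, hdφs₀, hθs₀, hus₀⟩ := hsl s₀ hs₀
  -- Step 10: the rows (the `let`s of the goal are substituted, everything is explicit)
  obtain ⟨hnodeM, hnodeE⟩ := hN₁ N hN k hk_mem
  dsimp only
  refine ⟨fun k' => ?_, ?_⟩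
  · -- momentum row `k′`: the one-body integrands at `s′` and at the node, in product form and in shape form
    set G' : T3 × V3 → ℝ := fun y => Torus.partialDeriv k' (φ s') y.1 *
        (θ₀ s' y.1 * (rhoLim (profileOf (a s') (ha s') (ha0 s')) σ y.1 * σ ^ 3) * deriv hsCompressibility (rhoLim (profileOf (a s') (ha s') (ha0 s')) σ y.1 * σ ^ 3) +
          (1 / 3) * (hsCompressibility (rhoLim (profileOf (a s') (ha s') (ha0 s')) σ y.1 * σ ^ 3) - 1) * ‖y.2 - u₀ s' y.1‖ ^ 2) with hG'
    set G : T3 × V3 → ℝ := fun y => Torus.partialDeriv k' (φ s₀) y.1 *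
        (θ₀ s₀ y.1 * (rhoLim (profileOf (a s₀) (ha s₀) (ha0 s₀)) σ y.1 * σ ^ 3) * deriv hsCompressibility (rhoLim (profileOf (a s₀) (ha s₀) (ha0 s₀)) σ y.1 * σ ^ 3) +
          (1 / 3) * (hsCompressibility (rhoLim (profileOf (a s₀) (ha s₀) (ha0 s₀)) σ y.1 * σ ^ 3) - 1) * ‖y.2 - u₀ s₀ y.1‖ ^ 2) with hG
    have hG'sh : ∀ y, G' y = pmF (s', y.1) k' + qmF (s', y.1) k' * ‖y.2 - u₀ s' y.1‖ ^ 2 +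
        ∑ l : Fin 3, (0 : ℝ) * (y.2 - u₀ s' y.1) l := by
      intro y; simp only [hG', hpmF, hqmF, hBF, hZ'F, hZF, hρF, Finset.sum_const_zero, zero_mul, add_zero]; ring
    have hGsh : ∀ y, G y = pmF (s₀, y.1) k' + qmF (s₀, y.1) k' * ‖y.2 - u₀ s₀ y.1‖ ^ 2 +
        ∑ l : Fin 3, (0 : ℝ) * (y.2 - u₀ s₀ y.1) l := by
      intro y; simp only [hG, hpmF, hqmF, hBF, hZ'F, hZF, hρF, Finset.sum_const_zero, zero_mul, add_zero]; ring
    have hGG : ∀ y, |G' y - G y| ≤ ω * E₁ + (ω * E₂) * ‖y.2‖ ^ 2 := by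
      intro y
      rw [hG'sh, hGsh]
      have h := abs_shape_sub_le (hmpm y.1 k') (hmqm y.1 k') (r := fun _ => (0 : ℝ)) (r' := fun _ => (0 : ℝ))
        (ωr := 0) (fun _ => by simp) (hmu y.1) (hqm_le s₀ hs₀ y.1 k') (R := 0) (fun _ => by simp)
        (hUb' s' hs' y.1) (hUb' s₀ hs₀ y.1) hω0.le le_rfl hω0.le y.2
      exact h.trans (mom_shape_budget hω0.le hU0 hR0 (sq_nonneg _))
    have hvec : ∀ l : Fin 3, Continuous fun v : V3 => v l := fun l => by fun_prop
    have hG'c : Continuous G' := by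
      rw [show G' = _ from funext hG'sh]
      refine (((continuous_apply k').comp ((continuous_slice_of_continuousOn hpmc hs').comp continuous_fst)).add
        (((continuous_apply k').comp ((continuous_slice_of_continuousOn hqmc hs').comp continuous_fst)).mul
          ((continuous_snd.sub (hus'.comp continuous_fst)).norm.pow 2))).add ?_
      exact continuous_finsetSum _ fun l _ =>
        continuous_const.mul ((hvec l).comp (continuous_snd.sub (hus'.comp continuous_fst)))
    have hGc : Continuous G := by
      rw [show G = _ from funext hGsh]
      refine (((continuous_apply k').comp ((continuous_slice_of_continuousOn hpmc hs₀).comp continuous_fst)).add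
        (((continuous_apply k').comp ((continuous_slice_of_continuousOn hqmc hs₀).comp continuous_fst)).mul
          ((continuous_snd.sub (hus₀.comp continuous_fst)).norm.pow 2))).add ?_
      exact continuous_finsetSum _ fun l _ =>
        continuous_const.mul ((hvec l).comp (continuous_snd.sub (hus₀.comp continuous_fst)))
    -- the centrings
    have hCC : |((τ * ((N : ℝ) + 1) ^ (-(1 / 3 : ℝ))) * ((N : ℝ) + 1) * ∫ x, rhoLim (profileOf (a s') (ha s') (ha0 s')) σ x * Torus.partialDeriv k' (φ s') x *
          (θ₀ s' x * (rhoLim (profileOf (a s') (ha s') (ha0 s')) σ x * σ ^ 3) * deriv hsCompressibility (rhoLim (profileOf (a s') (ha s') (ha0 s')) σ x * σ ^ 3))) -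
        ((τ * ((N : ℝ) + 1) ^ (-(1 / 3 : ℝ))) * ((N : ℝ) + 1) * ∫ x, rhoLim (profileOf (a s₀) (ha s₀) (ha0 s₀)) σ x * Torus.partialDeriv k' (φ s₀) x *
          (θ₀ s₀ x * (rhoLim (profileOf (a s₀) (ha s₀) (ha0 s₀)) σ x * σ ^ 3) * deriv hsCompressibility (rhoLim (profileOf (a s₀) (ha s₀) (ha0 s₀)) σ x * σ ^ 3)))| ≤
        ω * ((τ * ((N : ℝ) + 1) ^ (-(1 / 3 : ℝ))) * ((N : ℝ) + 1)) := by
      refine abs_mul_sub_mul_le (T := (τ * ((N : ℝ) + 1) ^ (-(1 / 3 : ℝ))) * ((N : ℝ) + 1)) (by positivity) ?_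
      have h := abs_integral_sub_integral_le (f := fun x => ImF (s', x) k') (f' := fun x => ImF (s₀, x) k')
        (hInt ((continuous_apply k').comp (continuous_slice_of_continuousOn hImc hs')))
        (hInt ((continuous_apply k').comp (continuous_slice_of_continuousOn hImc hs₀))) (fun x => hmIm x k')
      simpa only [hImF, hBF, hZ'F, hρF] using h
    -- measurable versions (S4) at `s′` and at the node
    obtain ⟨hM', -⟩ := stub_clampedFunctionalMeasurable σ N (Φ N) τ V
      ((τ * ((N : ℝ) + 1) ^ (-(1 / 3 : ℝ))) * ((N : ℝ) + 1) * ∫ x, rhoLim (profileOf (a s') (ha s') (ha0 s')) σ x * Torus.partialDeriv k' (φ s') x *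
          (θ₀ s' x * (rhoLim (profileOf (a s') (ha s') (ha0 s')) σ x * σ ^ 3) * deriv hsCompressibility (rhoLim (profileOf (a s') (ha s') (ha0 s')) σ x * σ ^ 3)))
      (φ s') G' hσ hσ2 hτpos (hLφ s' hs').1.continuous hG'c
    obtain ⟨hM, -⟩ := stub_clampedFunctionalMeasurable σ N (Φ N) τ V
      ((τ * ((N : ℝ) + 1) ^ (-(1 / 3 : ℝ))) * ((N : ℝ) + 1) * ∫ x, rhoLim (profileOf (a s₀) (ha s₀) (ha0 s₀)) σ x * Torus.partialDeriv k' (φ s₀) x *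
          (θ₀ s₀ x * (rhoLim (profileOf (a s₀) (ha s₀) (ha0 s₀)) σ x * σ ^ 3) * deriv hsCompressibility (rhoLim (profileOf (a s₀) (ha s₀) (ha0 s₀)) σ x * σ ^ 3)))
      (φ s₀) G hσ hσ2 hτpos (hLφ s₀ hs₀).1.continuous hGc
    exact row_chain (ε := ε) (κ := ε / 8) (c := ε / 16) (w := (τ * ((N : ℝ) + 1) ^ (-(1 / 3 : ℝ))))
      (μ := localGibbsLaw σ (a s₀) (u₀ s₀) (θ₀ s₀) N (Φ N)) (μ' := localGibbsLaw σ (a s') (u₀ s') (θ₀ s') N (Φ N))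
      (ψ := φ s₀) (ψ' := φ s') (G := G) (G' := G')
      (C := (τ * ((N : ℝ) + 1) ^ (-(1 / 3 : ℝ))) * ((N : ℝ) + 1) * ∫ x, rhoLim (profileOf (a s₀) (ha s₀) (ha0 s₀)) σ x * Torus.partialDeriv k' (φ s₀) x *
          (θ₀ s₀ x * (rhoLim (profileOf (a s₀) (ha s₀) (ha0 s₀)) σ x * σ ^ 3) * deriv hsCompressibility (rhoLim (profileOf (a s₀) (ha s₀) (ha0 s₀)) σ x * σ ^ 3)))
      (C' := (τ * ((N : ℝ) + 1) ^ (-(1 / 3 : ℝ))) * ((N : ℝ) + 1) * ∫ x, rhoLim (profileOf (a s') (ha s') (ha0 s')) σ x * Torus.partialDeriv k' (φ s') x *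
          (θ₀ s' x * (rhoLim (profileOf (a s') (ha s') (ha0 s')) σ x * σ ^ 3) * deriv hsCompressibility (rhoLim (profileOf (a s') (ha s') (ha0 s')) σ x * σ ^ 3)))
      (δ := fun v v' : V3 => v' k' - v k') hσ hτpos hVnn (by positivity) (Φ N) hPgood hP'L hLip hGc hG'c hGG hCC
      (abs_apply_sub_le_transfer k') rfl hlaw' hT' (hnodeM k') (hM k') (hM' k') hbudget hγ' hsum
  · -- energy row
    set G' : T3 × V3 → ℝ := fun y =>
        (∑ l : Fin 3, u₀ s' y.1 l * Torus.partialDeriv l (φ s') y.1) *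
          (θ₀ s' y.1 * (rhoLim (profileOf (a s') (ha s') (ha0 s')) σ y.1 * σ ^ 3) * deriv hsCompressibility (rhoLim (profileOf (a s') (ha s') (ha0 s')) σ y.1 * σ ^ 3) +
            (1 / 3) * (hsCompressibility (rhoLim (profileOf (a s') (ha s') (ha0 s')) σ y.1 * σ ^ 3) - 1) * ‖y.2 - u₀ s' y.1‖ ^ 2) +
        θ₀ s' y.1 * (hsCompressibility (rhoLim (profileOf (a s') (ha s') (ha0 s')) σ y.1 * σ ^ 3) - 1) *
          (∑ l : Fin 3, Torus.partialDeriv l (φ s') y.1 * (y.2 - u₀ s' y.1) l) with hG'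
    set G : T3 × V3 → ℝ := fun y =>
        (∑ l : Fin 3, u₀ s₀ y.1 l * Torus.partialDeriv l (φ s₀) y.1) *
          (θ₀ s₀ y.1 * (rhoLim (profileOf (a s₀) (ha s₀) (ha0 s₀)) σ y.1 * σ ^ 3) * deriv hsCompressibility (rhoLim (profileOf (a s₀) (ha s₀) (ha0 s₀)) σ y.1 * σ ^ 3) +
            (1 / 3) * (hsCompressibility (rhoLim (profileOf (a s₀) (ha s₀) (ha0 s₀)) σ y.1 * σ ^ 3) - 1) * ‖y.2 - u₀ s₀ y.1‖ ^ 2) +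
        θ₀ s₀ y.1 * (hsCompressibility (rhoLim (profileOf (a s₀) (ha s₀) (ha0 s₀)) σ y.1 * σ ^ 3) - 1) *
          (∑ l : Fin 3, Torus.partialDeriv l (φ s₀) y.1 * (y.2 - u₀ s₀ y.1) l) with hG
    have hG'sh : ∀ y, G' y = peF (s', y.1) + qeF (s', y.1) * ‖y.2 - u₀ s' y.1‖ ^ 2 +
        ∑ l : Fin 3, reF (s', y.1) l * (y.2 - u₀ s' y.1) l := by
      intro y
      simp only [hG', hpeF, hqeF, hreF, hsF, hBF, hZ'F, hZF, hρF, mul_sum_fin_three]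
      ring
    have hGsh : ∀ y, G y = peF (s₀, y.1) + qeF (s₀, y.1) * ‖y.2 - u₀ s₀ y.1‖ ^ 2 +
        ∑ l : Fin 3, reF (s₀, y.1) l * (y.2 - u₀ s₀ y.1) l := by
      intro y
      simp only [hG, hpeF, hqeF, hreF, hsF, hBF, hZ'F, hZF, hρF, mul_sum_fin_three]
      ring
    have hGG : ∀ y, |G' y - G y| ≤ ω * E₁ + (ω * E₂) * ‖y.2‖ ^ 2 := by
      intro y
      rw [hG'sh, hGsh]
      have h := abs_shape_sub_le (hmpe y.1) (hmqe y.1) (r := reF (s', y.1)) (r' := reF (s₀, y.1))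
        (fun l => hmre y.1 l) (hmu y.1) (hqe_le s₀ hs₀ y.1) (fun l => hre_le s₀ hs₀ y.1 l)
        (hUb' s' hs' y.1) (hUb' s₀ hs₀ y.1) hω0.le hω0.le hω0.le y.2
      exact h.trans (en_shape_budget ω U Q R _)
    have hvec : ∀ l : Fin 3, Continuous fun v : V3 => v l := fun l => by fun_prop
    have hG'c : Continuous G' := by
      rw [show G' = _ from funext hG'sh]
      refine (((continuous_slice_of_continuousOn hpec hs').comp continuous_fst).add
        (((continuous_slice_of_continuousOn hqec hs').comp continuous_fst).mul
          ((continuous_snd.sub (hus'.comp continuous_fst)).norm.pow 2))).add ?_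
      exact continuous_finsetSum _ fun l _ =>
        ((continuous_apply l).comp ((continuous_slice_of_continuousOn hrec hs').comp continuous_fst)).mul
          ((hvec l).comp (continuous_snd.sub (hus'.comp continuous_fst)))
    have hGc : Continuous G := by
      rw [show G = _ from funext hGsh]
      refine (((continuous_slice_of_continuousOn hpec hs₀).comp continuous_fst).add
        (((continuous_slice_of_continuousOn hqec hs₀).comp continuous_fst).mul
          ((continuous_snd.sub (hus₀.comp continuous_fst)).norm.pow 2))).add ?_
      exact continuous_finsetSum _ fun l _ =>
        ((continuous_apply l).comp ((continuous_slice_of_continuousOn hrec hs₀).comp continuous_fst)).mul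
          ((hvec l).comp (continuous_snd.sub (hus₀.comp continuous_fst)))
    have hCC : |((τ * ((N : ℝ) + 1) ^ (-(1 / 3 : ℝ))) * ((N : ℝ) + 1) * ∫ x, rhoLim (profileOf (a s') (ha s') (ha0 s')) σ x * (∑ l : Fin 3, u₀ s' x l * Torus.partialDeriv l (φ s') x) *
          (θ₀ s' x * (rhoLim (profileOf (a s') (ha s') (ha0 s')) σ x * σ ^ 3) * deriv hsCompressibility (rhoLim (profileOf (a s') (ha s') (ha0 s')) σ x * σ ^ 3))) -
        ((τ * ((N : ℝ) + 1) ^ (-(1 / 3 : ℝ))) * ((N : ℝ) + 1) * ∫ x, rhoLim (profileOf (a s₀) (ha s₀) (ha0 s₀)) σ x * (∑ l : Fin 3, u₀ s₀ x l * Torus.partialDeriv l (φ s₀) x) *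
          (θ₀ s₀ x * (rhoLim (profileOf (a s₀) (ha s₀) (ha0 s₀)) σ x * σ ^ 3) * deriv hsCompressibility (rhoLim (profileOf (a s₀) (ha s₀) (ha0 s₀)) σ x * σ ^ 3)))| ≤
        ω * ((τ * ((N : ℝ) + 1) ^ (-(1 / 3 : ℝ))) * ((N : ℝ) + 1)) := by
      refine abs_mul_sub_mul_le (T := (τ * ((N : ℝ) + 1) ^ (-(1 / 3 : ℝ))) * ((N : ℝ) + 1)) (by positivity) ?_
      have h := abs_integral_sub_integral_le (f := fun x => IeF (s', x)) (f' := fun x => IeF (s₀, x))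
        (hInt (continuous_slice_of_continuousOn hIec hs')) (hInt (continuous_slice_of_continuousOn hIec hs₀)) hmIe
      simpa only [hIeF, hsF, hBF, hZ'F, hρF] using h
    obtain ⟨-, hM'⟩ := stub_clampedFunctionalMeasurable σ N (Φ N) τ V
      ((τ * ((N : ℝ) + 1) ^ (-(1 / 3 : ℝ))) * ((N : ℝ) + 1) * ∫ x, rhoLim (profileOf (a s') (ha s') (ha0 s')) σ x * (∑ l : Fin 3, u₀ s' x l * Torus.partialDeriv l (φ s') x) *
          (θ₀ s' x * (rhoLim (profileOf (a s') (ha s') (ha0 s')) σ x * σ ^ 3) * deriv hsCompressibility (rhoLim (profileOf (a s') (ha s') (ha0 s')) σ x * σ ^ 3)))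
      (φ s') G' hσ hσ2 hτpos (hLφ s' hs').1.continuous hG'c
    obtain ⟨-, hM⟩ := stub_clampedFunctionalMeasurable σ N (Φ N) τ V
      ((τ * ((N : ℝ) + 1) ^ (-(1 / 3 : ℝ))) * ((N : ℝ) + 1) * ∫ x, rhoLim (profileOf (a s₀) (ha s₀) (ha0 s₀)) σ x * (∑ l : Fin 3, u₀ s₀ x l * Torus.partialDeriv l (φ s₀) x) *
          (θ₀ s₀ x * (rhoLim (profileOf (a s₀) (ha s₀) (ha0 s₀)) σ x * σ ^ 3) * deriv hsCompressibility (rhoLim (profileOf (a s₀) (ha s₀) (ha0 s₀)) σ x * σ ^ 3)))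
      (φ s₀) G hσ hσ2 hτpos (hLφ s₀ hs₀).1.continuous hGc
    exact row_chain (ε := ε) (κ := ε / 8) (c := ε / 16) (w := (τ * ((N : ℝ) + 1) ^ (-(1 / 3 : ℝ))))
      (μ := localGibbsLaw σ (a s₀) (u₀ s₀) (θ₀ s₀) N (Φ N)) (μ' := localGibbsLaw σ (a s') (u₀ s') (θ₀ s') N (Φ N))
      (ψ := φ s₀) (ψ' := φ s') (G := G) (G' := G')
      (C := (τ * ((N : ℝ) + 1) ^ (-(1 / 3 : ℝ))) * ((N : ℝ) + 1) * ∫ x, rhoLim (profileOf (a s₀) (ha s₀) (ha0 s₀)) σ x * (∑ l : Fin 3, u₀ s₀ x l * Torus.partialDeriv l (φ s₀) x) *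
          (θ₀ s₀ x * (rhoLim (profileOf (a s₀) (ha s₀) (ha0 s₀)) σ x * σ ^ 3) * deriv hsCompressibility (rhoLim (profileOf (a s₀) (ha s₀) (ha0 s₀)) σ x * σ ^ 3)))
      (C' := (τ * ((N : ℝ) + 1) ^ (-(1 / 3 : ℝ))) * ((N : ℝ) + 1) * ∫ x, rhoLim (profileOf (a s') (ha s') (ha0 s')) σ x * (∑ l : Fin 3, u₀ s' x l * Torus.partialDeriv l (φ s') x) *
          (θ₀ s' x * (rhoLim (profileOf (a s') (ha s') (ha0 s')) σ x * σ ^ 3) * deriv hsCompressibility (rhoLim (profileOf (a s') (ha s') (ha0 s')) σ x * σ ^ 3)))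
      (δ := fun v v' : V3 => (‖v'‖ ^ 2 - ‖v‖ ^ 2) / 2) hσ hτpos hVnn (by positivity) (Φ N) hPgood hP'L hLip hGc hG'c hGG
      hCC abs_energy_sub_le_transfer rfl hlaw' hT' hnodeE hM hM' hbudget hγ' hsum

end Summit.AtomisticToContinuum.HydrodynamicLimit.Theorems.LocalClampedTransferSketch

end
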